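import Summits.QuantumFields.YangMills.Theorems.BalabanUVNodesN21CollarJunctionLevelLedger
import Summits.QuantumFields.YangMills.Theorems.BalabanUVNodesN21CollarJunctionLowCentreSanity

/-!
# N21 (NE7c) · A2 ∕ A6 WITNESS of the collar-junction level ledger (38r′): every binder of
# `…N21CollarJunctionLevelLedger.levelLedger_of_lowCentre_collar` discharged on one live slot per step

R141 (C) seat pub-ymgap-dag-n21-e (g18), node N21 = NE7c (single-run shell-weight bound, NOT PRINTED in [Bałaban
1983–89], NOT proved), strategy s3 ALTERNATIVE CURRENCY, lane K3⁷ `SpineGivenEndpointR13SepCoPH`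
(stmt-QuantumFields-20544, `--kind proof --supports … --as helper`).  Sibling of 38r `…N21CollarJunctionLevelLedger`
(split for the 400-line rule): its §1 ★ `levelLedger_of_lowCentre_collar` APPLIED with EVERY binder discharged in the
kernel (director-ym STANDING A6 RULE №189 (3)) — 38m′'s one-point witness
(`…N21CollarJunctionLowCentreSanity.collarJunctionLowCentre_binders_inhabited`) in LEDGER form: `σ = ι = Unit`, one live
slot and one term per step, exterior `Unit` under `dirac ()`, block `ℝ²`, kept cut `{|w₁| < 1}` (convex — `convex_absSlab`
—, reads no collar coordinate: 38m §1 `condOdds_keptCuts` exercised), Gaussian potential `Σᵢ wᵢ²∕2`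
(`convexOn_gaussianPotential_two`), centre `0` (low), `U = |w₁|` (transversal, `κ₀ = 1`, `θ = 1`, `ρ ≡ ½`), `C⋆ = univ`,
ONE collar coordinate `0` with the letter `(−1, 1)` carried into `(−7∕6, 7∕6)` at the Gaussian species odds
`Q₀ = 2c∕(1−c)`, `c = e∕3` (38l `hodds_absLetter_of_partialSlopes` on 38k `gaussianBlock_inwardSlopes`); the slot's piece
and the term weight are the restricted cut law's shell ∕ total mass ([dict] with equality), `sh = piece`, level letters
`M ≡ 1 + Q₀`, `d ≡ 2` — §1 FIRES (`collarJunctionLedger_binders_inhabited`); the witness is LIVE (one slot and one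
term per step, `lvl K () = K`): the slot ∕ term ∕ level data are those of n21-w2's
`…N21RecentredRoadLevelLedger.recentredDilationLedger_witness_live`, cited BY NAME, not restated.

HONEST FRAMING.  [textbook]; 0 def, 0 sorry; a satisfiability witness, not an estimate on Bałaban's measure; NE7c NOT
PRINTED ∕ NOT proved; N21 NOT discharged; counts unmoved (typed 28∕28 · discharged 5∕27); count-neutral; one finite 𝕋⁴
at fixed ε — nothing about ℝ⁴ ∕ OS ∕ mass gap ∕ Clay.
-/

set_option autoImplicit false

open MeasureTheory Set Function
open scoped ENNReal

namespace Summit.QuantumFields.YangMills.Theorems.N21CollarJunctionLevelLedgerSanity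

open Literature.MathematicalPhysics.QuantumFieldTheory.Balaban1983to89
open T4ShellMeasureLevels (LevelLedger)
open N21CollarJunctionLowCentre (measurable_fibreIndicator withDensity_fibreIndicator_eq_restrict condOdds_keptCuts
  hcore_of_starConvex)
open N21CollarJunctionLevelLedger (levelLedger_of_lowCentre_collar)
open N21CollarOddsBlockFrame (isFiniteMeasure_blockGaussianWeight)
open N21CollarLetterOdds (gaussianBlock_inwardSlopes)
open N21CollarEnvelopeOdds (hodds_absLetter_of_partialSlopes)
open N21CollarJunctionLowCentreSanity (convex_absSlab convexOn_gaussianPotential_two)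

/-- **EVERY BINDER OF `levelLedger_of_lowCentre_collar` DISCHARGED ON ONE LIVE SLOT PER STEP (A2 ∕ A6).**  Data:
`σ = ι = Unit`, `S K = T K = {()}`, `lvl K () = K`; frame `Unit × (Fin 2 → ℝ)`, `ζ = dirac ()`, kept cut
`Kcut = {|w₁| < 1}` (convex, reads no collar coordinate), Gaussian potential `φ = Σᵢ wᵢ²∕2` (convex), centre `m = 0 ∈ Kcut`
(LOW: `φ(0) = 0`), `U p = |p.2 1|`, `C⋆ = univ`, ONE collar coordinate `0` with support letter `(−1, 1)` carried into the
envelope letter `(−7∕6, 7∕6)` at the Gaussian species odds `Q₀ = 2c∕(1−c)`, `c = e∕3` (38l `hodds_absLetter_of_partialSlopes`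
on 38k `gaussianBlock_inwardSlopes`, transported under the cut by 38m `condOdds_keptCuts`), `θ = 1`, `ρ ≡ ½`, `κ₀ = 1`,
`M₀ = 1`; the slot's piece and the term weight are the restricted cut law's shell ∕ total mass (the [dict] push holds with
equality), `sh = piece`; level letters `M ≡ 1 + Q₀`, `d ≡ 2`.  The road binders `hlow` ∕ `hletter` ∕ `hcore` ∕ `hRT` ∕
`hodds` are all proved here (38m′'s witness, ledger form) — §1 FIRES; liveness of the slot ∕ term data is n21-w2's
`recentredDilationLedger_witness_live` (same `S`, `T`, `lvl`).  A satisfiability witness, not an estimate on Bałaban's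
measure. [textbook] -/
theorem collarJunctionLedger_binders_inhabited (l₀ : ℝ) :
    LevelLedger l₀ (fun _ : ℕ => ({()} : Finset Unit))
      (fun (_ : ℕ) (_ : ℝ) (_ : Unit) =>
        (((((Measure.dirac ()).prod (volume : Measure (Fin 2 → ℝ))).withDensity
            fun p : Unit × (Fin 2 → ℝ) => ({w : Fin 2 → ℝ | |w 1| < 1}).indicator
              (fun w => ENNReal.ofReal (Real.exp (-(∑ i, w i ^ 2 / 2)))) p.2).restrict
          ({p : Unit × (Fin 2 → ℝ) | |p.2 1| < 1} ∩
            (univ ∩ ⋂ i ∈ ({0} : Finset (Fin 2)), {q : Unit × (Fin 2 → ℝ) | q.2 i ∈ Ioo (-1 : ℝ) 1}))) univ).toReal)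
      (fun (_ : ℕ) (_ : ℝ) (_ : Unit) =>
        (((((Measure.dirac ()).prod (volume : Measure (Fin 2 → ℝ))).withDensity
            fun p : Unit × (Fin 2 → ℝ) => ({w : Fin 2 → ℝ | |w 1| < 1}).indicator
              (fun w => ENNReal.ofReal (Real.exp (-(∑ i, w i ^ 2 / 2)))) p.2).restrict
          ({p : Unit × (Fin 2 → ℝ) | |p.2 1| < 1} ∩
            (univ ∩ ⋂ i ∈ ({0} : Finset (Fin 2)), {q : Unit × (Fin 2 → ℝ) | q.2 i ∈ Ioo (-1 : ℝ) 1})))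
          {p | 1 * (1 - 1 / 2) ≤ |p.2 1| ∧ |p.2 1| < 1}).toReal)
      (fun _ : ℕ => ({()} : Finset Unit))
      (fun (_ : ℕ) (_ : ℝ) (_ : Unit) (_ : Unit) =>
        (((((Measure.dirac ()).prod (volume : Measure (Fin 2 → ℝ))).withDensity
            fun p : Unit × (Fin 2 → ℝ) => ({w : Fin 2 → ℝ | |w 1| < 1}).indicator
              (fun w => ENNReal.ofReal (Real.exp (-(∑ i, w i ^ 2 / 2)))) p.2).restrict
          ({p : Unit × (Fin 2 → ℝ) | |p.2 1| < 1} ∩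
            (univ ∩ ⋂ i ∈ ({0} : Finset (Fin 2)), {q : Unit × (Fin 2 → ℝ) | q.2 i ∈ Ioo (-1 : ℝ) 1})))
          {p | 1 * (1 - 1 / 2) ≤ |p.2 1| ∧ |p.2 1| < 1}).toReal)
      (fun (K : ℕ) (_ : Unit) => K)
      (fun j => (fun _ : ℕ => (1 + 2 * (Real.exp 1 * 2 * ((7 : ℝ) / 6 - 1) / (1 - Real.exp 1 * 2 * ((7 : ℝ) / 6 - 1)))))
        j * (3 * ((fun _ : ℕ => (2 : ℝ)) j + 1) / (1 - (fun _ : ℕ => (1 / 2 : ℝ)) j)))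
      (fun _ : ℕ => (1 / 2 : ℝ)) := by
  -- measurability ∕ finiteness of the frame data (38m′)
  have hA : Measurable fun p : Unit × (Fin 2 → ℝ) => ∑ i, p.2 i ^ 2 / 2 :=
    Finset.measurable_sum _ fun i _ => (((measurable_pi_apply i).comp measurable_snd).pow_const 2).div_const 2
  have hF : Measurable fun p : Unit × (Fin 2 → ℝ) => ENNReal.ofReal (Real.exp (-(∑ i, p.2 i ^ 2 / 2))) :=
    ENNReal.measurable_ofReal.comp (Real.measurable_exp.comp hA.neg)
  have hKhat : MeasurableSet {p : Unit × (Fin 2 → ℝ) | p.2 ∈ {w : Fin 2 → ℝ | |w 1| < 1}} :=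
    measurableSet_lt ((measurable_pi_apply 1).comp measurable_snd).abs measurable_const
  have hK1 : ∀ (_ : Unit) (w : Fin 2 → ℝ) (y : ℝ),
      update w 0 y ∈ {w : Fin 2 → ℝ | |w 1| < 1} ↔ w ∈ {w : Fin 2 → ℝ | |w 1| < 1} := by
    intro _ w y
    simp only [mem_setOf_eq, update_of_ne (show (1 : Fin 2) ≠ 0 by decide)]
  have hg : Measurable fun p : Unit × (Fin 2 → ℝ) =>
      ({w : Fin 2 → ℝ | |w 1| < 1}).indicator (fun w => ENNReal.ofReal (Real.exp (-(∑ i, w i ^ 2 / 2)))) p.2 :=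
    measurable_fibreIndicator (fun _ : Unit => {w : Fin 2 → ℝ | |w 1| < 1}) hKhat
      (F := fun (_ : Unit) (w : Fin 2 → ℝ) => ENNReal.ofReal (Real.exp (-(∑ i, w i ^ 2 / 2)))) hF
  haveI := isFiniteMeasure_blockGaussianWeight (κ := Fin 2)
  have hfin : IsFiniteMeasure (((Measure.dirac ()).prod (volume : Measure (Fin 2 → ℝ))).withDensity
      fun p : Unit × (Fin 2 → ℝ) =>
        ({w : Fin 2 → ℝ | |w 1| < 1}).indicator (fun w => ENNReal.ofReal (Real.exp (-(∑ i, w i ^ 2 / 2)))) p.2) := by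
    rw [withDensity_fibreIndicator_eq_restrict _ (fun _ : Unit => {w : Fin 2 → ℝ | |w 1| < 1}) hKhat
      (fun (_ : Unit) (w : Fin 2 → ℝ) => ENNReal.ofReal (Real.exp (-(∑ i, w i ^ 2 / 2))))]
    infer_instance
  have hU : Measurable fun p : Unit × (Fin 2 → ℝ) => |p.2 1| := ((measurable_pi_apply 1).comp measurable_snd).abs
  have he : Real.exp 1 * 2 * ((7 : ℝ) / 6 - 1) < 1 := by nlinarith [Real.exp_one_lt_d9]
  have hq0 : 0 ≤ 2 * (Real.exp 1 * 2 * ((7 : ℝ) / 6 - 1) / (1 - Real.exp 1 * 2 * ((7 : ℝ) / 6 - 1))) :=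
    mul_nonneg zero_le_two (div_nonneg (by positivity) (sub_nonneg.2 he.le))
  have hl01 : ∀ l ∈ Icc (1 - 1 / ((Fintype.card (Fin 2) : ℝ) + 1)) (1 : ℝ), 0 ≤ l ∧ l ≤ 1 := by
    intro l hl
    have h := hl.1
    simp only [Fintype.card_fin, Nat.cast_ofNat] at h
    exact ⟨by linarith, hl.2⟩
  refine levelLedger_of_lowCentre_collar (X := fun _ _ => Unit) (κ := fun _ _ => Fin 2)
    (θ := fun _ _ _ => 1) (κ₀ := fun _ _ _ => 1) (M₀ := fun _ _ _ => 1)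
    (Mlvl := fun _ => 1 + 2 * (Real.exp 1 * 2 * ((7 : ℝ) / 6 - 1) / (1 - Real.exp 1 * 2 * ((7 : ℝ) / 6 - 1))))
    (d := fun _ => 2)
    (fun _ _ _ => Measure.dirac ()) (fun _ _ _ => inferInstance)
    (m := fun _ _ _ _ => 0) (fun _ _ _ => measurable_const)
    (fun _ _ _ _ => {w : Fin 2 → ℝ | |w 1| < 1}) (fun _ _ _ _ w => ∑ i, w i ^ 2 / 2) (fun _ _ _ => hg)
    (fun _ _ _ _ _ => hfin)
    (U := fun _ _ _ p => |p.2 1|) (fun _ _ _ => hU)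
    (Cstar := fun _ _ _ => univ) (fun _ _ _ => MeasurableSet.univ)
    (fun _ _ _ => {0}) (fun _ _ _ _ => Ioo (-1 : ℝ) 1) (fun _ _ _ _ => Ioo (-(7 / 6) : ℝ) (7 / 6))
    (fun _ _ _ _ _ => measurableSet_Ioo) (fun _ _ _ _ _ => measurableSet_Ioo)
    (fun _ _ _ _ _ => Ioo_subset_Ioo (by norm_num) (by norm_num))
    (fun _ _ _ _ => 2 * (Real.exp 1 * 2 * ((7 : ℝ) / 6 - 1) / (1 - Real.exp 1 * 2 * ((7 : ℝ) / 6 - 1))))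
    (fun _ _ _ _ _ => hq0) ?_ ?_ (fun _ _ _ _ _ _ _ _ => by simp)
    (fun _ _ _ => one_pos) (fun _ => by norm_num) (fun _ => by norm_num) (fun _ _ _ => one_pos)
    (fun _ _ _ _ => convex_absSlab)
    (fun _ _ _ _ => convexOn_gaussianPotential_two.subset (subset_univ _) convex_absSlab) ?_ ?_ ?_ ?_ ?_
    (fun _ _ _ _ _ => zero_le_one) ?_ ?_ ?_ ?_ ?_ (fun _ => add_nonneg zero_le_one hq0) ?_ (fun _ => zero_le_two)
    (fun _ _ _ => by simp)
  · -- hodds: the kept letter on coordinate `0`, transported under the cut (38m §1) from 38l §2's Gaussian species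
    intro K t _ s _ i hi C hC hCi
    obtain rfl : i = 0 := by simpa using hi
    exact condOdds_keptCuts ((Measure.dirac ()).prod volume) (fun _ : Unit => {w : Fin 2 → ℝ | |w 1| < 1}) hKhat
      (fun (_ : Unit) (w : Fin 2 → ℝ) => ENNReal.ofReal (Real.exp (-(∑ i, w i ^ 2 / 2)))) hK1
      measurableSet_Ioo measurableSet_Ioo
      (fun C hC hCi => hodds_absLetter_of_partialSlopes (Measure.dirac ()) hA 0 (by norm_num) (by norm_num)
        (by norm_num) he (gaussianBlock_inwardSlopes 0).1 (gaussianBlock_inwardSlopes 0).2 C hC hCi) C hC hCi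
  · -- the slot statistic reads no collar coordinate
    intro K t s i hi z w y
    obtain rfl : i = 0 := by simpa using hi
    show |update w 0 y 1| = |w 1|
    rw [update_of_ne (by decide)]
  · -- the centre lies in the kept cut
    intro _ _ _ _
    show |(0 : Fin 2 → ℝ) 1| < 1
    simp
  · -- hlow: the centre `0` minimises the Gaussian potential
    intro K t _ s _ p _ _ _ _
    exact le_trans (le_of_eq (by simp)) (Finset.sum_nonneg fun i _ => by positivity)
  · -- hletter: the kept letter on coordinate `0` is carried into the relaxed letter
    intro K t _ s _ i hi l hl z w hw
    obtain rfl : i = 0 := by simpa using hi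
    obtain ⟨hl0, hl1⟩ := hl01 l hl
    simp only [Pi.add_apply, Pi.zero_apply, Pi.smul_apply, smul_eq_mul, sub_zero, zero_add, mem_Ioo] at hw ⊢
    constructor
    · nlinarith [mul_nonneg hl0 (show (0 : ℝ) ≤ w 0 + 1 by linarith [hw.1])]
    · nlinarith [mul_nonneg hl0 (show (0 : ℝ) ≤ 1 - w 0 by linarith [hw.2])]
  · -- hcore: the core fibre `{|w₁| < 1}` is convex and contains the centre (38m §2 `hcore_of_starConvex`)
    intro K t _ s _
    have hl₀ : (0 : ℝ) ≤ 1 - 1 / ((Fintype.card (Fin 2) : ℝ) + 1) := by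
      simp only [Fintype.card_fin, Nat.cast_ofNat]
      norm_num
    refine hcore_of_starConvex (fun _ => (0 : Fin 2 → ℝ)) (fun p : Unit × (Fin 2 → ℝ) => |p.2 1|) univ hl₀ ?_
    intro p _ _ _
    show StarConvex ℝ (0 : Fin 2 → ℝ)
      {w : Fin 2 → ℝ | |w 1| < 1 ∧ ((p.1, w) : Unit × (Fin 2 → ℝ)) ∈ (univ : Set (Unit × (Fin 2 → ℝ)))}
    have hset : {w : Fin 2 → ℝ | |w 1| < 1 ∧ ((p.1, w) : Unit × (Fin 2 → ℝ)) ∈ (univ : Set (Unit × (Fin 2 → ℝ)))}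
        = {w : Fin 2 → ℝ | |w 1| < 1} := by
      ext w
      simp only [mem_setOf_eq, mem_univ, and_true]
    rw [hset]
    exact convex_absSlab.starConvex (by simp)
  · -- hRT: `U = |w₁|` is radially transversal with `κ₀ = 1` on `{½ ≤ U}`
    intro K t _ s _ p h1 _ _ r hr _ _ _
    have h1' : 1 / 2 ≤ |p.2 1| := by have h := h1; norm_num at h; exact h
    simp only [zero_add, sub_zero, Pi.smul_apply, smul_eq_mul]
    rw [abs_mul, abs_of_nonneg (by linarith : (0 : ℝ) ≤ r)]
    nlinarith [mul_nonneg (show (0 : ℝ) ≤ r - 1 by linarith) (show (0 : ℝ) ≤ |p.2 1| - 1 / 2 by linarith)]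
  · -- hpiece: the slot's piece IS the shell mass (M₀ = 1)
    intro K t _ s _
    simp
  · -- hAw: the term weight IS the total mass (M₀ = 1)
    intro K t _ s _
    simp
  · -- sh_nonneg
    intro K t _ τ _
    exact ENNReal.toReal_nonneg
  · -- sh_le: shell mass ≤ total mass of the (finite) restricted cut law
    intro K t _ τ _
    haveI := hfin
    exact ENNReal.toReal_mono (measure_ne_top _ _) (measure_mono (subset_univ _))
  · -- cover: the single slot's piece covers the shell part
    intro K t _ τ _
    simp
  · -- hMlvl: `∏_{i ∈ {0}} (1 + Q₀) ∕ 1 = 1 + Q₀`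
    intro K t _ s _
    simp

end Summit.QuantumFields.YangMills.Theorems.N21CollarJunctionLevelLedgerSanity
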